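import Summits.HodgeConjecture.HodgeConjecture.Theses.HeckePrymWeil

/-!
# Route HeckePrymWeil — the glue `LadderGlue` (item stmt-HodgeConjecture-14499)

The support item `LadderGlue` of route `route-HodgeConjecture-HeckePrymWeil` is the implication

`HeckePrymAnchors → WeilVariationalHodge → IsoInvariance → ProductDescent → WeilDescending → HodgeWeilLadder`.

It is pure logic and ℕ-arithmetic.  Write `HWA(p, n)` for the rung predicate of `HodgeWeilLadder`
in dimension `2n` (every rational `(n,n)` Hodge–Weil class of every `(A, φ)` with `A.dim = 2n`,
`φ ≫ φ = -p`, is algebraic), and put `m = (p - 1) / 2` (`≥ 3` since `p ≥ 7`).  The rung `(p, g)`,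
`g ≥ 2`, of the ladder is `HWA(p, m * (g - 1))`.  To reach it:

* **top rung one level up.**  Let `n₀ + 1 = m * g`.  For every `(A, φ)` of dimension `2 n₀`,
  `HeckePrymAnchors` at `(p, g + 1)` with `k := n₀ + 1` supplies a Weil surface `(B, ψ)` such that
  every rational `(n₀+1, n₀+1)` Weil class `c` of `(A × B, φ × ψ)` is ANCHORED: it is `e^*(W|_{s₁})`
  for a smooth projective family `f : 𝒳 → S` of Weil-type abelian `(2n₀+2)`-folds over a smooth
  irreducible base, an iso `e : A × B ≅ 𝒳_{s₁}` and a global class `W` with rational `(k,k)` fibre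
  restrictions, algebraic at some `s₀`.  `WeilVariationalHodge` (at `M = n₀ + 1`) makes `W|_{s₁}`
  algebraic, `IsoInvariance` transports it across `e`, so `c` is algebraic.  This is verbatim the
  hypothesis of `ProductDescent` at `n₀`, whose conclusion is `HWA(p, n₀)`.
* **descent.**  `WeilDescending` gives `HWA(p, n + 1) → HWA(p, n)` for `n ≥ 1`; applied
  `n₀ - m * (g - 1) = m - 1` times it yields the rung.

The combinatorial core is `heckePrymWeil_ladder_glue_logic`, stated over an abstract rung predicate
`P : ℕ → Prop` so that the (long) rung predicate is supplied by unification, exactly as in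
`Theorems/HeckePrymWeilAssembly.lean`.
-/

-- every declaration of this problem lives in `Summit.HodgeConjecture.HodgeConjecture.…` (summit = sub-problem)
set_option linter.dupNamespace false

namespace Summit.HodgeConjecture.HodgeConjecture.Theorems

open Summit.HodgeConjecture.HodgeConjecture.Theses.HeckePrymWeil

/-- **Ladder glue, abstract form** (pure ℕ-arithmetic).  Let `P` be a predicate on ℕ and `m ≥ 1` a
step.  If `P n` holds at every `n` with `n + 1 = m * g`, `g ≥ 2` (the rung one level up, shifted
down by one), and `P` descends one step at a time (`P (n + 1) → P n` for `n ≥ 1`, phrased with the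
successor bound by an equation as in `WeilDescending`), then `P` holds at every rung
`n = m * (g - 1)`, `g ≥ 2`: descend `m - 1` times from `m * g - 1`. -/
theorem heckePrymWeil_ladder_glue_logic (P : ℕ → Prop) (m : ℕ) (hm : 1 ≤ m)
    (hTop : ∀ g : ℕ, 2 ≤ g → ∀ n : ℕ, n + 1 = m * g → P n)
    (hDesc : ∀ n : ℕ, 1 ≤ n → (∀ n' : ℕ, n' = n + 1 → P n') → P n) :
    ∀ g : ℕ, 2 ≤ g → ∀ n : ℕ, n = m * (g - 1) → P n := by
  intro g hg n hn
  rw [Nat.mul_sub_one] at hn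
  have hmg : m * 2 ≤ m * g := Nat.mul_le_mul (le_refl m) hg
  -- `key d`: every `k ≥ 1` at distance `d + 1` below `m * g` satisfies `P`.
  have key : ∀ d k : ℕ, 1 ≤ k → k + d + 1 = m * g → P k := by
    intro d
    induction d with
    | zero =>
      intro k hk hkd
      exact hTop g hg k (by omega)
    | succ d ih =>
      intro k hk hkd
      exact hDesc k hk fun n' hn' => ih n' (by omega) (by omega)
  exact key (m - 1) n (by omega) (by omega)

/-- **Glue of route HeckePrymWeil** (item stmt-HodgeConjecture-14499):
`HeckePrymAnchors → WeilVariationalHodge → IsoInvariance → ProductDescent → WeilDescending → HodgeWeilLadder`.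
For the rung `(p, g)` apply `heckePrymWeil_ladder_glue_logic` with step `m = (p - 1) / 2` (the rung
predicate `HWA(p, ·)` being supplied by unification): the descent hypothesis is `WeilDescending`
at `p`; the top hypothesis at `n₀` (`n₀ + 1 = m * g`) is `ProductDescent` at `n₀`, whose product
hypothesis is discharged, for each `(A, φ)` of dimension `2 n₀`, by the Weil surface and the
anchored families of `HeckePrymAnchors` at `(p, g + 1)`, `k = n₀ + 1`, made algebraic at the
anchored fibre by `WeilVariationalHodge` (`M = n₀ + 1`) and transported to `A × B` by
`IsoInvariance`. -/
theorem heckePrymWeil_ladderGlue_proof :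
    Summit.HodgeConjecture.HodgeConjecture.Theses.HeckePrymWeil.LadderGlue := by
  unfold Summit.HodgeConjecture.HodgeConjecture.Theses.HeckePrymWeil.LadderGlue
  intro hA hV hI hP hD p hp hp4 hp7
  refine heckePrymWeil_ladder_glue_logic _ ((p - 1) / 2) (by omega) ?_ (hD p hp hp4 hp7)
  intro g hg n₀ hn₀
  -- `n₀ ≥ 5`: the step is `≥ 3` and `g ≥ 2`
  have h6 : 3 * 2 ≤ (p - 1) / 2 * g := Nat.mul_le_mul (by omega) hg
  have hk : n₀ + 1 = (p - 1) / 2 * (g + 1 - 1) := by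
    rw [Nat.add_sub_cancel]
    exact hn₀
  refine hP p hp hp4 hp7 n₀ (by omega) ?_
  intro A φ hdim hφ
  obtain ⟨B, ψ, hB, hψ, hb, hfam⟩ :=
    hA p hp hp4 hp7 (g + 1) (by omega) n₀ (n₀ + 1) rfl hk A φ hdim hφ
  refine ⟨B, ψ, hB, hψ, hb, fun c hc hH hW => ?_⟩
  obtain ⟨𝒳, S, f, s₁, s₀, e, W, hsm, hirr, hS, hWs, hfib, he, halg⟩ := hfam c hc hH hW
  have h₁ := hV p hp hp4 hp7 (n₀ + 1) (by omega) f hsm hirr hS W hWs hfib ⟨s₀, halg⟩ s₁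
  rw [← he]
  exact hI e (n₀ + 1) _ h₁

end Summit.HodgeConjecture.HodgeConjecture.Theorems
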